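import Summits.AtomisticToContinuum.HydrodynamicLimit.Theorems.EquilibriumClampedCollisionalWindowLD.Negative.PulseInvariant

/-!
# Newton-cradle pulse, part 5: step facts, the invariant along the block, phases (helper file, refutation of `EquilibriumClampedCollisionalWindowLD`, stmt-AtomisticToContinuum-13733, layer L3; see `Cruxes/EquilibriumClampedCollisionalWindowLD/Disproof.lean`, evidence WITNESS.md §4.3; no Theses declaration is asserted; refuter-cdisprove-stmt-AtomisticToContinuum-13733-0)

`StepFacts`/`stepFacts_of_inv`, `inv_all`, `stepFacts`, monotone hit times, phase formulas, first coarse bounds.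
-/

noncomputable section

open Real
open scoped InnerProductSpace

namespace Summit.AtomisticToContinuum.HydrodynamicLimit.Theorems

namespace EquilibriumClampedCollisionalWindowLDNegative

section BlockAll

variable {E : Type*} [NormedAddCommGroup E] [InnerProductSpace ℝ E]

section BlockAnalysis

variable {P : Params} {e : E} {D : BlockData E}

/-- Consequences of the invariant at stage `k` for the transfer `k → k+1` (when the target's data
are controlled, `k + 1 ≤ K`). -/
structure StepFacts (P : Params) (e : E) (D : BlockData E) (k : ℕ) : Prop where
  geom : StepGeom P e D k
  cont : StepContact P e D k
  inv' : Inv P e D (k + 1)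
  c_le : ck P e D k ≤ P.Vhi
  W_le : ‖(carrier P e D k).W‖ ≤ P.Vhi
  ρ_le : ‖ρk P e D k‖ ≤ P.ρs
  energy : ck P e D k * (ck P e D k - 2 * P.u) ≤
    ‖(carrier P e D (k + 1)).W‖ ^ 2 - ‖D.η (k + 1)‖ ^ 2

set_option maxHeartbeats 800000 in
/-- **The inductive step of the block analysis.** -/
theorem stepFacts_of_inv (hP : P.Admissible) (hD : DataOK P e D) {k : ℕ} (hk : Inv P e D k)
    (hkK : k + 1 ≤ P.K) : StepFacts P e D k := by
  have hg := stepGeom_of_inv hP hD hk hkK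
  have hct := stepContact_of_geom hP hD hg
  set c := carrier P e D k with hc
  set U := relVel D k c with hU
  have hUdef : U = c.W - D.η (k + 1) := rfl
  have hε := hP.ε_pos
  have hV := hP.V_pos
  have hu := hP.u_nn
  have hVlo := hP.Vlo_pos
  have hUVhi : ‖U‖ ≤ P.Vhi := hg.U_le
  have hη1 := hg.η_le
  have hn1 := hct.n_unit
  have hclo := hP.clo_pos
  have hc_ge := hct.c_ge
  have hcpos : 0 < ck P e D k := hclo.trans_le hc_ge
  have hηc : ‖D.η (k + 1)‖ < ck P e D k := lt_of_le_of_lt hη1 (hP.u_lt_clo.trans_le hc_ge)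
  have hck : ck P e D k = ⟪U, nk P e D k⟫_ℝ := rfl
  -- kinematics
  obtain ⟨-, -, hW'lo, hW'hi, hW'dir, hEn, hρ1, -⟩ :=
    transfer_kinematics (U := U) (η := D.η (k + 1)) hn1 hck.symm hηc
  have hW' : (carrier P e D (k + 1)).W = D.η (k + 1) + ck P e D k • nk P e D k := rfl
  rw [← hW'] at hW'lo hW'hi hW'dir hEn
  set p := ‖perpC (relPos P e D k c) U‖ with hp
  have hp0 : 0 ≤ p := norm_nonneg _
  have hp_ps : p ≤ P.ps := hct.p_le
  have hpε : p ≤ P.ε := hp_ps.trans (hP.ps_le.trans (by linarith))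
  have hp2 : p ^ 2 ≤ P.ps ^ 2 := pow_le_pow_left₀ hp0 hp_ps 2
  have hx : p ^ 2 / P.ε ^ 2 ≤ P.ps ^ 2 / P.ε ^ 2 :=
    div_le_div_of_nonneg_right hp2 (by positivity)
  have hx0 : 0 ≤ p ^ 2 / P.ε ^ 2 := by positivity
  have hclow := hct.c_ge'
  have hcup := hct.c_le
  -- residual velocity
  have hρ_le : ‖ρk P e D k‖ ≤ P.ρs := by
    have hρeq : ρk P e D k = U + D.η (k + 1) - ck P e D k • nk P e D k := by
      rw [ρk, hUdef]; abel
    have hres := norm_sub_inner_smul_le (U := U) hn1 hε hp0 hpε hclow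
    rw [← hck] at hres
    rw [hρeq]
    have hVhi0 : 0 ≤ P.Vhi := hP.Vhi_pos.le
    have hprod : 2 * ‖U‖ * p ≤ 2 * P.Vhi * P.ps := by
      have := mul_le_mul hUVhi hp_ps hp0 hVhi0
      linarith
    calc ‖U + D.η (k + 1) - ck P e D k • nk P e D k‖
        ≤ ‖U - ck P e D k • nk P e D k‖ + ‖D.η (k + 1)‖ := hρ1
      _ ≤ 2 * ‖U‖ * p / P.ε + P.u := add_le_add hres hη1
      _ ≤ 2 * P.Vhi * P.ps / P.ε + P.u := by
          have := div_le_div_of_nonneg_right hprod hε.le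
          linarith
      _ = P.ρs := rfl
  -- the new invariant
  have hdVdef : P.dV = 2 * P.u + 2 * P.V * (P.ps ^ 2 / P.ε ^ 2) := rfl
  have hxU : ‖U‖ * (p ^ 2 / P.ε ^ 2) ≤ 2 * P.V * (P.ps ^ 2 / P.ε ^ 2) := by
    have h1 : ‖U‖ ≤ 2 * P.V := hUVhi.trans hP.Vhi_le
    calc ‖U‖ * (p ^ 2 / P.ε ^ 2) ≤ 2 * P.V * (p ^ 2 / P.ε ^ 2) :=
          mul_le_mul_of_nonneg_right h1 hx0
      _ ≤ 2 * P.V * (P.ps ^ 2 / P.ε ^ 2) := mul_le_mul_of_nonneg_left hx (by linarith)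
  have hVx : 0 ≤ 2 * P.V * (P.ps ^ 2 / P.ε ^ 2) := by positivity
  have hcast : ((k + 1 : ℕ) : ℝ) = (k : ℝ) + 1 := by push_cast; ring
  have hinv' : Inv P e D (k + 1) := by
    refine ⟨?_, ?_, ?_, ?_, rfl⟩
    · rw [tHit_succ, hcast]
      have := hk.t_ge; have := hct.θ_ge
      have : ((k : ℝ) + 1) * P.θlo = k * P.θlo + P.θlo := by ring
      linarith
    · rw [tHit_succ, hcast]
      have := hk.t_le; have := hct.θ_le
      have : ((k : ℝ) + 1) * P.θhi = k * P.θhi + P.θhi := by ring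
      linarith
    · -- speed drift
      rw [abs_le, hcast]
      have hWlo := hg.W_ge
      have hWhi := hg.W_le
      have hUlo := hg.U_ge'
      have hUhi := hg.U_le'
      have hdistr : ‖U‖ * (1 - p ^ 2 / P.ε ^ 2) = ‖U‖ - ‖U‖ * (p ^ 2 / P.ε ^ 2) := by ring
      have hk1 : ((k : ℝ) + 1) * P.dV = k * P.dV + P.dV := by ring
      constructor
      · linarith
      · linarith
    · -- direction
      have hndir := hct.n_dir
      calc ‖(‖(carrier P e D (k + 1)).W‖)⁻¹ • (carrier P e D (k + 1)).W - e‖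
          ≤ ‖(‖(carrier P e D (k + 1)).W‖)⁻¹ • (carrier P e D (k + 1)).W - nk P e D k‖ +
              ‖nk P e D k - e‖ := norm_sub_le_norm_sub_add_norm_sub _ _ _
        _ ≤ 2 * ‖D.η (k + 1)‖ / (ck P e D k - ‖D.η (k + 1)‖) + P.αn := add_le_add hW'dir hndir
        _ ≤ 2 * P.u / (P.clo - P.u) + P.αn := by
            refine add_le_add ?_ le_rfl
            have hcu := hP.u_lt_clo
            rw [div_le_div_iff₀ (by linarith) (by linarith)]
            have hprod : ‖D.η (k + 1)‖ * P.clo ≤ P.u * ck P e D k :=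
              mul_le_mul hη1 hc_ge hclo.le hu
            linarith
        _ ≤ P.αs := by have := hP.α_closes; linarith
  -- energy received
  have henergy : ck P e D k * (ck P e D k - 2 * P.u) ≤
      ‖(carrier P e D (k + 1)).W‖ ^ 2 - ‖D.η (k + 1)‖ ^ 2 := by
    rw [hEn]
    have h1 : |⟪D.η (k + 1), nk P e D k⟫_ℝ| ≤ P.u := by
      calc |⟪D.η (k + 1), nk P e D k⟫_ℝ| ≤ ‖D.η (k + 1)‖ * ‖nk P e D k‖ := abs_real_inner_le_norm _ _
        _ ≤ P.u := by rw [hn1, mul_one]; exact hη1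
    have h2 := (abs_le.1 h1).1
    have h3 : 2 * ck P e D k * (-P.u) ≤ 2 * ck P e D k * ⟪D.η (k + 1), nk P e D k⟫_ℝ :=
      mul_le_mul_of_nonneg_left h2 (by linarith)
    linarith
  exact ⟨hg, hct, hinv', hcup.trans hUVhi, by have := hg.W_le'; linarith, hρ_le, henergy⟩

/-- **The invariant holds all along the block** (`k ≤ K`). -/
theorem inv_all (hP : P.Admissible) (hD : DataOK P e D) : ∀ k, k ≤ P.K → Inv P e D k
  | 0, _ => inv_zero hP hD
  | k + 1, hk => (stepFacts_of_inv hP hD (inv_all hP hD k ((Nat.le_succ k).trans hk)) hk).inv'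

/-- All the facts of every transfer of the block (`k + 1 ≤ K`). -/
theorem stepFacts (hP : P.Admissible) (hD : DataOK P e D) {k : ℕ} (hk : k + 1 ≤ P.K) :
    StepFacts P e D k :=
  stepFacts_of_inv hP hD (inv_all hP hD k ((Nat.le_succ k).trans hk)) hk

end BlockAnalysis

/-! ## The block trajectory: phases, monotone hit times, position/velocity bounds, separation -/

section BlockTrajectory

variable {P : Params} {e : E} {D : BlockData E}

/-- Hit times are strictly increasing along the controlled part of the block. -/
theorem tHit_lt_succ (hP : P.Admissible) (hD : DataOK P e D) {k : ℕ} (hk : k + 1 ≤ P.K) :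
    tHit P e D k < tHit P e D (k + 1) := by
  rw [tHit_succ]; have := (stepFacts hP hD hk).cont.θ_pos; linarith

/-- Hit times are strictly increasing. [folklore] -/
theorem tHit_strictMonoOn (hP : P.Admissible) (hD : DataOK P e D) {j k : ℕ} (hjk : j < k)
    (hk : k ≤ P.K) : tHit P e D j < tHit P e D k := by
  induction k with
  | zero => exact absurd hjk (Nat.not_lt_zero _)
  | succ k ih =>
    rcases Nat.lt_succ_iff_lt_or_eq.1 hjk with h | h
    · exact (ih h ((Nat.le_succ k).trans hk)).trans (tHit_lt_succ hP hD hk)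
    · rw [h]; exact tHit_lt_succ hP hD hk

/-- Hit times are monotone. [folklore] -/
theorem tHit_mono (hP : P.Admissible) (hD : DataOK P e D) {j k : ℕ} (hjk : j ≤ k)
    (hk : k ≤ P.K) : tHit P e D j ≤ tHit P e D k := by
  rcases hjk.eq_or_lt with h | h
  · rw [h]
  · exact (tHit_strictMonoOn hP hD h hk).le

/-- Hit times are nonnegative. [folklore] -/
theorem tHit_nonneg (hP : P.Admissible) (hD : DataOK P e D) {k : ℕ} (hk : k ≤ P.K) :
    0 ≤ tHit P e D k := by
  have := tHit_mono hP hD (Nat.zero_le k) hk; simpa using this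

/-- Lower bound on hit times. [folklore] -/
theorem tHit_ge (hP : P.Admissible) (hD : DataOK P e D) {k : ℕ} (hk : k ≤ P.K) :
    (k : ℝ) * P.θlo ≤ tHit P e D k := (inv_all hP hD k hk).t_ge

/-- Upper bound on hit times. [folklore] -/
theorem tHit_le (hP : P.Admissible) (hD : DataOK P e D) {k : ℕ} (hk : k ≤ P.K) :
    tHit P e D k ≤ (k : ℝ) * P.θhi := (inv_all hP hD k hk).t_le

/-! ### Phase formulas -/

/-- `pos_untouched` (technical, see the section header). [folklore] -/
theorem pos_untouched {k : ℕ} {t : ℝ} (ht : t < tHit P e D k) :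
    pos P e D k t = base P e D k + t • D.η k := by
  simp [pos, ht]

/-- Velocity in the untouched phase. [folklore] -/
theorem vel_untouched {k : ℕ} {t : ℝ} (ht : t < tHit P e D k) : vel P e D k t = D.η k := by
  simp [vel, ht]

/-- Position in the carrier phase. [folklore] -/
theorem pos_carrier {k : ℕ} {t : ℝ} (h1 : tHit P e D k ≤ t) (h2 : t < tHit P e D (k + 1)) :
    pos P e D k t = (carrier P e D k).p + (t - tHit P e D k) • (carrier P e D k).W := by
  simp [pos, not_lt.2 h1, h2]

/-- Velocity in the carrier phase. [folklore] -/
theorem vel_carrier {k : ℕ} {t : ℝ} (h1 : tHit P e D k ≤ t) (h2 : t < tHit P e D (k + 1)) :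
    vel P e D k t = (carrier P e D k).W := by
  simp [vel, not_lt.2 h1, h2]

/-- Position in the spent phase. [folklore] -/
theorem pos_spent {k : ℕ} {t : ℝ} (h1 : tHit P e D k ≤ t) (h2 : tHit P e D (k + 1) ≤ t) :
    pos P e D k t = qk P e D k + (t - tHit P e D (k + 1)) • ρk P e D k := by
  simp [pos, not_lt.2 h1, not_lt.2 h2]

/-- Velocity in the spent phase. [folklore] -/
theorem vel_spent {k : ℕ} {t : ℝ} (h1 : tHit P e D k ≤ t) (h2 : tHit P e D (k + 1) ≤ t) :
    vel P e D k t = ρk P e D k := by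
  simp [vel, not_lt.2 h1, not_lt.2 h2]

/-- At time `0` every sphere sits at its slot (plus perturbation). [folklore] -/
theorem pos_zero (hP : P.Admissible) (hD : DataOK P e D) (hK : 1 ≤ P.K) {k : ℕ} (hk : k ≤ P.K) :
    pos P e D k 0 = base P e D k := by
  rcases Nat.eq_zero_or_pos k with h | h
  · subst h
    have h1 : (0 : ℝ) < tHit P e D 1 := by
      have := tHit_lt_succ hP hD (k := 0) (by omega); simpa using this
    rw [pos_carrier (by simp) (by simpa using h1)]
    simp [base]
  · have h1 : (0 : ℝ) < tHit P e D k := by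
      have := tHit_strictMonoOn hP hD h hk; simpa using this
    rw [pos_untouched h1, zero_smul, add_zero]

/-- At time `0` every sphere has its initial velocity. [folklore] -/
theorem vel_zero (hP : P.Admissible) (hD : DataOK P e D) (hK : 1 ≤ P.K) {k : ℕ} (hk : k ≤ P.K) :
    vel P e D k 0 = D.η k := by
  rcases Nat.eq_zero_or_pos k with h | h
  · subst h
    have h1 : (0 : ℝ) < tHit P e D 1 := by
      have := tHit_lt_succ hP hD (k := 0) (by omega); simpa using this
    rw [vel_carrier (by simp) (by simpa using h1)]
    simp
  · have h1 : (0 : ℝ) < tHit P e D k := by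
      have := tHit_strictMonoOn hP hD h hk; simpa using this
    rw [vel_untouched h1]

/-- The carrier's launch position is where the untouched flight ends (positions are continuous at
`tHit k`). -/
theorem carrier_p_eq (hP : P.Admissible) (hD : DataOK P e D) {k : ℕ} (hk : k ≤ P.K) :
    (carrier P e D k).p = base P e D k + tHit P e D k • D.η k := (inv_all hP hD k hk).p_eq

/-- Continuity of positions at `tHit (k+1)`: the spent flight starts where the carrier flight ends. -/
theorem qk_eq (k : ℕ) :
    qk P e D k = (carrier P e D k).p + (tHit P e D (k + 1) - tHit P e D k) • (carrier P e D k).W := by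
  rw [qk, tHit_succ, add_sub_cancel_left]

/-- The geometric meaning of the contact normal: at the transfer time the target sits at
`ε n_k` from the spent carrier. -/
theorem p_succ_sub_qk (hP : P.Admissible) (hD : DataOK P e D) {k : ℕ} (hk : k + 1 ≤ P.K) :
    (carrier P e D (k + 1)).p - qk P e D k = P.ε • nk P e D k := by
  have hct := (stepFacts hP hD hk).cont
  rw [hct.εn_eq, carrier_succ_p, qk, relPos, relVel, tHit_succ, θk]
  simp only [tHit]
  module

/-! ### Where every sphere is, coarsely: never backwards by more than `errA`, never further than
`fwd` from its slot -/

/-- The (coarse) forward reach and backward error of a block. -/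
def Params.errA (P : Params) : ℝ := P.r + P.Tmax * P.u + P.Tmax * P.ρs
/-- The (coarse) forward reach of a sphere of the block. [folklore] -/
def Params.fwd (P : Params) : ℝ := P.θhi * P.Vhi + (P.r + P.Tmax * P.u) + P.Tmax * P.ρs

/-- `errA ≥ 0`. [folklore] -/
theorem Params.Admissible.errA_nn {P : Params} (h : P.Admissible) : 0 ≤ P.errA := by
  have := h.r_nn; have := h.u_nn; have := h.T_nn; have := h.ρs_nn; unfold Params.errA; positivity

/-- Inner product with the unit axis is at most the norm. -/
theorem inner_e_le_norm (he : ‖e‖ = 1) (x : E) : ⟪x, e⟫_ℝ ≤ ‖x‖ := by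
  calc ⟪x, e⟫_ℝ ≤ ‖x‖ * ‖e‖ := real_inner_le_norm _ _
    _ = ‖x‖ := by rw [he, mul_one]

/-- Inner product with the unit axis is at least minus the norm. [folklore] -/
theorem neg_norm_le_inner_e (he : ‖e‖ = 1) (x : E) : -‖x‖ ≤ ⟪x, e⟫_ℝ := by
  have := inner_e_le_norm he (-x)
  rw [inner_neg_left, norm_neg] at this
  linarith

/-- For unit vectors, `⟪n, e⟫ = 1 - ‖n - e‖²/2`. -/
theorem inner_eq_one_sub_of_unit {n : E} (hn : ‖n‖ = 1) (he : ‖e‖ = 1) :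
    ⟪n, e⟫_ℝ = 1 - ‖n - e‖ ^ 2 / 2 := by
  have h := norm_sub_sq_real n e
  rw [hn, he] at h
  linarith

/-- A carrier's velocity points forward: `⟪W, e⟫ ≥ ‖W‖ (1 - αs²/2) ≥ 0`. -/
theorem inner_W_e_ge (hP : P.Admissible) (hD : DataOK P e D) {k : ℕ} (hk : k ≤ P.K) :
    ‖(carrier P e D k).W‖ * (1 - P.αs ^ 2 / 2) ≤ ⟪(carrier P e D k).W, e⟫_ℝ := by
  have hinv := inv_all hP hD k hk
  set W := (carrier P e D k).W with hW
  by_cases hW0 : W = 0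
  · simp [hW0]
  have hWpos : 0 < ‖W‖ := norm_pos_iff.2 hW0
  have hŴ : ‖(‖W‖)⁻¹ • W‖ = 1 := by
    rw [norm_smul, norm_inv, norm_norm, inv_mul_cancel₀ hWpos.ne']
  have h1 := inner_eq_one_sub_of_unit hŴ hD.e_unit
  have h2 : ‖(‖W‖)⁻¹ • W - e‖ ^ 2 ≤ P.αs ^ 2 := pow_le_pow_left₀ (norm_nonneg _) hinv.dir 2
  have h3 : ⟪W, e⟫_ℝ = ‖W‖ * ⟪(‖W‖)⁻¹ • W, e⟫_ℝ := by
    rw [real_inner_smul_left, ← mul_assoc, mul_inv_cancel₀ hWpos.ne', one_mul]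
  rw [h3, h1]
  exact mul_le_mul_of_nonneg_left (by linarith) hWpos.le

/-- A carrier's velocity has a nonnegative axial component. [folklore] -/
theorem inner_W_e_nonneg (hP : P.Admissible) (hD : DataOK P e D) (hαs : P.αs ≤ 1) {k : ℕ}
    (hk : k ≤ P.K) : 0 ≤ ⟪(carrier P e D k).W, e⟫_ℝ := by
  have := inner_W_e_ge hP hD hk
  have h2 : 0 ≤ ‖(carrier P e D k).W‖ * (1 - P.αs ^ 2 / 2) :=
    mul_nonneg (norm_nonneg _) (by nlinarith [hP.αs_nn])
  linarith

/-- The length of a carrier flight: `θ_k ‖W_k‖ ≤ θhi · Vhi`. -/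
theorem θ_mul_W_le (hP : P.Admissible) (hD : DataOK P e D) {k : ℕ} (hk : k + 1 ≤ P.K) :
    θk P e D k * ‖(carrier P e D k).W‖ ≤ P.θhi * P.Vhi := by
  have hf := stepFacts hP hD hk
  exact mul_le_mul hf.cont.θ_le hf.W_le (norm_nonneg _) hP.θhi_pos.le

/-- Coarse position bounds, untouched phase. -/
theorem pos_bounds_untouched (hP : P.Admissible) (hD : DataOK P e D) {k : ℕ} (hk1 : 1 ≤ k)
    (hk : k ≤ P.K) {t : ℝ} (ht0 : 0 ≤ t) (htT : t ≤ P.Tmax) (ht : t < tHit P e D k) :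
    ‖pos P e D k t - ((k : ℝ) * P.s) • e‖ ≤ P.r + P.Tmax * P.u := by
  rw [pos_untouched ht, base]
  have : ((k : ℝ) * P.s) • e + D.ξ k + t • D.η k - ((k : ℝ) * P.s) • e = D.ξ k + t • D.η k := by
    abel
  rw [this]
  calc ‖D.ξ k + t • D.η k‖ ≤ ‖D.ξ k‖ + ‖t • D.η k‖ := norm_add_le _ _
    _ ≤ P.r + P.Tmax * P.u := by
        refine add_le_add (hD.ξ_le k hk) ?_
        rw [norm_smul, Real.norm_of_nonneg ht0]
        exact mul_le_mul htT (hD.η_le k hk1 hk) (norm_nonneg _) hP.T_nn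


end BlockTrajectory

end BlockAll

end EquilibriumClampedCollisionalWindowLDNegative

end Summit.AtomisticToContinuum.HydrodynamicLimit.Theorems

end
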